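import Literature.Probability.LatticeModels.EffectiveResistance
import Literature.Probability.LatticeModels.DomainDiscretisation
import HarnessLib

/-!
# The discrete extremal length of a lattice annulus is bounded below
(line `symplectic-fermion-anchor`, crux `SAWLoopFugacityFlow.AvoidanceLimit`, stmt-CriticalPhenomena-10649;
base brick of the (CR) toolbox toward the analytic stub `stub_annularCrossRatio`: the input "the discrete
extremal length of the annulus `B(p, σ) → ℂ ∖ B(p, 2σ)` on `δℤ²` is bounded below uniformly in `δ ≤ σ/40`
and `p`" of D. Chelkak, Y. Wan, Electron. J. Probab. 26 (2021) paper 54, proof of Lemma 3.7, via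
D. Chelkak, *Robust discrete complex analysis: a toolbox*, Ann. Probab. 44 (2016), §6)

Duffin's discrete extremal length `extremalLength G c A Z = sup_W dist_W(A, Z)² / Σ_e c(e) W(e)²`
(`Literature/Probability/LatticeModels/EffectiveResistance.lean`) is a supremum over metrics, so ONE test
metric suffices. With `c := nearestSite δ p`, the sup-norm ring index `k(v) := ‖v - c‖_∞ ∈ ℕ` and the
scale `s := σ/δ ≥ 40`, `4(r + 4) ≤ s < 4(r + 4) + 4` (`r ≥ 6`), we take the indicator metric `W` of the
lattice edges with both endpoints in the box `{k ≤ N}`, `N := 5(r + 4)`: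

* `walkLength_ge_min_sub_min` — **layer crossing**: if `k` increases by at most one along every edge and
  `W ≥ 1` on the edges inside `{k ≤ N}`, then `min N k(y) - min N k(x) ≤ length_W(γ)` for every walk
  `γ : x ⤳ y` (induction on the walk);
* the inner ball `B(p, σ)` lies in `{k ≤ 4(r + 4) + 4}` (`|re|, |im| ≤ ‖·‖`) and the exterior of
  `B(p, 2σ)` in `{N ≤ k}` (`‖z‖ ≤ √2 max(|re z|, |im z|)`, `√2 < 3/2`), so `dist_W(A, Z) ≥ r`;
* `networkArea_le_of_box` — a metric bounded by `1` and supported on the lattice edges with both endpoints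
  in a box of sup-radius `N` has area `≤ 2 (2N + 1)²` (the edges are among `s(x, x + eᵢ)`, `x` in the
  box, `i : Fin 2`);
* hence `EL ≥ r² / (2 (10 r + 41)²) ≥ 1/4000`.

All statements are folklore (Chelkak 2016, §6, "discrete extremal length of annuli"). No definitions.
-/

noncomputable section

open scoped ENNReal NNReal
open Literature.Probability.LatticeModels

namespace Summit.CriticalPhenomena.SAWScalingLimit.Theorems.AvoidanceLimit.Anchor

/-- **Layer crossing.** If an integer index `k` on the vertices increases by at most one along every
edge of `G` and the metric `W` is at least `1` on every edge with both endpoints in `{k ≤ N}`, then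
along every walk the truncated index `min N (k ·)` increases by at most the `W`-length of the walk.
[folklore] -/
theorem walkLength_ge_min_sub_min {V : Type*} {G : SimpleGraph V} (k : V → ℤ) (N : ℤ)
    (W : Sym2 V → ℝ≥0) (hk : ∀ ⦃x y : V⦄, G.Adj x y → k y ≤ k x + 1)
    (hW : ∀ ⦃x y : V⦄, G.Adj x y → k x ≤ N → k y ≤ N → (1 : ℝ) ≤ W s(x, y)) {x y : V}
    (p : G.Walk x y) :
    ((min N (k y) : ℤ) : ℝ) - ((min N (k x) : ℤ) : ℝ) ≤ (walkLength W p : ℝ) := by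
  induction p with
  | nil => simp
  | @cons a b _ h p ih =>
    rw [walkLength_cons, NNReal.coe_add]
    have hab := hk h
    by_cases hc : k a ≤ N ∧ k b ≤ N
    · have h1 := hW h hc.1 hc.2
      have h2 : ((min N (k b) : ℤ) : ℝ) ≤ ((min N (k a) : ℤ) : ℝ) + 1 := by
        have : min N (k b) ≤ min N (k a) + 1 := by omega
        exact_mod_cast this
      linarith
    · have h2 : ((min N (k b) : ℤ) : ℝ) ≤ ((min N (k a) : ℤ) : ℝ) := by
        have : min N (k b) ≤ min N (k a) := by omega
        exact_mod_cast this
      have h3 : (0 : ℝ) ≤ W s(a, b) := (W _).coe_nonneg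
      linarith

/-- **Area of a box metric.** A metric on the unordered pairs of `ℤ²` that is bounded by `1` and vanishes
on every lattice edge not having both endpoints in the box of sup-radius `N` around `c` has area at most
`2 (2N + 1)²` on the unit network `ℤ²`: such edges are among the `s(x, x + eᵢ)` with `x` in the box and
`i : Fin 2`. [folklore] -/
theorem networkArea_le_of_box (c : Site 2) (N : ℕ) (W : Sym2 (Site 2) → ℝ≥0) (hle : ∀ e, W e ≤ 1)
    (hsupp : ∀ x y : Site 2, (zdGraph 2).Adj x y → W s(x, y) ≠ 0 →
      (∀ i, c i - N ≤ x i ∧ x i ≤ c i + N) ∧ (∀ i, c i - N ≤ y i ∧ y i ≤ c i + N)) :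
    networkArea (zdGraph 2) 1 W ≤ ((2 * (2 * N + 1) ^ 2 : ℕ) : ℝ≥0∞) := by
  classical
  set box : Finset (Site 2) := Fintype.piFinset fun i : Fin 2 => Finset.Icc (c i - N) (c i + N)
    with hbox
  set T : Finset (Sym2 (Site 2)) :=
    (box ×ˢ (Finset.univ : Finset (Fin 2))).image fun q => s(q.1, q.1 + Pi.single q.2 1) with hT
  have hmem_box : ∀ x : Site 2, (∀ i, c i - N ≤ x i ∧ x i ≤ c i + N) → x ∈ box := fun x hx => by
    rw [hbox, Fintype.mem_piFinset]
    intro i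
    rw [Finset.mem_Icc]
    exact hx i
  set F : Sym2 (Site 2) → ℝ≥0∞ := fun e =>
    (zdGraph 2).edgeSet.indicator (fun e => ((1 : Sym2 (Site 2) → ℝ≥0) e : ℝ≥0∞) * (W e : ℝ≥0∞) ^ 2) e
    with hF
  have hF1 : ∀ e, F e ≤ 1 := fun e => by
    refine Set.indicator_apply_le' (fun _ => ?_) (fun _ => zero_le_one)
    rw [Pi.one_apply, ENNReal.coe_one, one_mul]
    exact pow_le_one₀ bot_le (by exact_mod_cast hle e)
  have hF0 : ∀ e, e ∉ T → F e = 0 := by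
    intro e
    induction e using Sym2.inductionOn with
    | hf x y =>
      intro he
      by_contra hne
      have hE : s(x, y) ∈ (zdGraph 2).edgeSet := by
        by_contra h'
        exact hne (Set.indicator_of_notMem h' _)
      have hW0 : W s(x, y) ≠ 0 := by
        intro h0
        apply hne
        simp only [hF, Set.indicator_of_mem hE, h0, ENNReal.coe_zero]
        simp
      have hadj : (zdGraph 2).Adj x y := (SimpleGraph.mem_edgeSet _).1 hE
      obtain ⟨hx, hy⟩ := hsupp x y hadj hW0
      apply he
      rw [hT, Finset.mem_image]
      obtain ⟨i, h | h⟩ := (zdGraph_adj_iff x y).1 hadj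
      · exact ⟨(x, i), Finset.mem_product.2 ⟨hmem_box x hx, Finset.mem_univ _⟩, by rw [h]⟩
      · exact ⟨(y, i), Finset.mem_product.2 ⟨hmem_box y hy, Finset.mem_univ _⟩,
          by rw [h, Sym2.eq_swap]⟩
  have hcard_box : box.card = (2 * N + 1) ^ 2 := by
    rw [hbox, Fintype.card_piFinset, Fin.prod_univ_two, Int.card_Icc, Int.card_Icc]
    have h0 : (c 0 + N + 1 - (c 0 - N)).toNat = 2 * N + 1 := by omega
    have h1 : (c 1 + N + 1 - (c 1 - N)).toNat = 2 * N + 1 := by omega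
    rw [h0, h1, sq]
  have hcard_T : T.card ≤ 2 * (2 * N + 1) ^ 2 := by
    calc T.card ≤ (box ×ˢ (Finset.univ : Finset (Fin 2))).card := Finset.card_image_le
      _ = 2 * (2 * N + 1) ^ 2 := by
        rw [Finset.card_product, hcard_box, Finset.card_univ, Fintype.card_fin, mul_comm]
  calc networkArea (zdGraph 2) 1 W = ∑' e, F e := rfl
    _ = ∑ e ∈ T, F e := tsum_eq_sum hF0
    _ ≤ ∑ e ∈ T, (1 : ℝ≥0∞) := Finset.sum_le_sum fun e _ => hF1 e
    _ = T.card := by simp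
    _ ≤ ((2 * (2 * N + 1) ^ 2 : ℕ) : ℝ≥0∞) := by exact_mod_cast hcard_T

/-- **The discrete extremal length of a lattice annulus is bounded below** (Chelkak–Wan 2021, proof of
Lemma 3.7; Chelkak 2016, §6): there is an absolute constant `c₀ > 0` such that for every centre `p ∈ ℂ`,
every mesh `δ > 0` and every radius `σ ≥ 40 δ`, the discrete extremal length on `δℤ²` (unit conductances)
between the mesh vertices of the disc `B(p, σ)` and those of `ℂ ∖ B(p, 2σ)` is at least `c₀`
(here `c₀ = 1/4000`). [folklore] -/
theorem extremalLength_annulus_lowerBound :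
    ∃ c₀ : ℝ≥0∞, 0 < c₀ ∧ ∀ (p : ℂ) (δ σ : ℝ), 0 < δ → 40 * δ ≤ σ →
      c₀ ≤ extremalLength (zdGraph 2) (1 : Sym2 (Site 2) → ℝ≥0)
        {v : Site 2 | dist (meshPoint δ v) p < σ} {v : Site 2 | 2 * σ ≤ dist (meshPoint δ v) p} := by
  refine ⟨(4000 : ℝ≥0∞)⁻¹, by simp, fun p δ σ hδ hσ => ?_⟩
  have hσ0 : 0 < σ := lt_of_lt_of_le (by positivity) hσ
  -- the scale `s = σ / δ ≥ 40` and the integer parameter `r ≥ 6` with `4 (r + 4) ≤ s < 4 (r + 4) + 4`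
  obtain ⟨r, hr, hrs, hsr⟩ : ∃ r : ℕ, 6 ≤ r ∧ 4 * ((r : ℝ) + 4) * δ ≤ σ ∧
      σ < (4 * ((r : ℝ) + 4) + 4) * δ := by
    have h10 : 10 ≤ ⌊σ / δ / 4⌋₊ := Nat.le_floor (by
      rw [le_div_iff₀ (by norm_num : (0 : ℝ) < 4), le_div_iff₀ hδ]; push_cast; linarith)
    refine ⟨⌊σ / δ / 4⌋₊ - 4, by omega, ?_, ?_⟩
    · have h := Nat.floor_le (div_nonneg (div_nonneg hσ0.le hδ.le) (by norm_num) : 0 ≤ σ / δ / 4)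
      rw [le_div_iff₀ (by norm_num : (0 : ℝ) < 4), le_div_iff₀ hδ] at h
      rw [Nat.cast_sub (by omega)]
      push_cast
      linarith
    · have h := Nat.lt_floor_add_one (σ / δ / 4)
      rw [div_lt_iff₀ (by norm_num : (0 : ℝ) < 4), div_lt_iff₀ hδ] at h
      rw [Nat.cast_sub (by omega)]
      push_cast
      linarith
  -- the centre and the ring index
  set c : Site 2 := nearestSite δ p with hc
  have hcp : dist (meshPoint δ c) p ≤ δ := dist_meshPoint_nearestSite_le hδ p
  obtain ⟨k, hk⟩ : ∃ k : Site 2 → ℤ,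
      ∀ a, k a = max (max (a 0 - c 0) (c 0 - a 0)) (max (a 1 - c 1) (c 1 - a 1)) := ⟨_, fun _ => rfl⟩
  have hk_adj : ∀ ⦃x y : Site 2⦄, (zdGraph 2).Adj x y → k y ≤ k x + 1 := by
    intro x y hxy
    rw [hk, hk]
    obtain ⟨i, h | h⟩ := (zdGraph_adj_iff x y).1 hxy
    · subst h
      fin_cases i <;> simp <;> omega
    · subst h
      fin_cases i <;> simp <;> omega
  -- coordinates of mesh differences
  have hre : ∀ a : Site 2, |(meshPoint δ a - meshPoint δ c).re| = δ * |((a 0 : ℤ) : ℝ) - c 0| := by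
    intro a
    rw [Complex.sub_re, meshPoint_re, meshPoint_re, ← mul_sub, abs_mul, abs_of_pos hδ]
  have him : ∀ a : Site 2, |(meshPoint δ a - meshPoint δ c).im| = δ * |((a 1 : ℤ) : ℝ) - c 1| := by
    intro a
    rw [Complex.sub_im, meshPoint_im, meshPoint_im, ← mul_sub, abs_mul, abs_of_pos hδ]
  -- the inner disc lies in the box `{k ≤ 4 (r + 4) + 4}`
  have hinner : ∀ a : Site 2, dist (meshPoint δ a) p < σ → k a ≤ 4 * (r + 4) + 4 := by
    intro a ha
    have h1 : ‖meshPoint δ a - meshPoint δ c‖ < (4 * ((r : ℝ) + 4) + 5) * δ := by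
      rw [← Complex.dist_eq]
      calc dist (meshPoint δ a) (meshPoint δ c)
          ≤ dist (meshPoint δ a) p + dist (meshPoint δ c) p := dist_triangle_right _ _ _
        _ < (4 * ((r : ℝ) + 4) + 4) * δ + δ := add_lt_add_of_lt_of_le (ha.trans hsr) hcp
        _ = (4 * ((r : ℝ) + 4) + 5) * δ := by ring
    have h2 := (Complex.abs_re_le_norm _).trans_lt h1
    have h3 := (Complex.abs_im_le_norm _).trans_lt h1
    rw [hre, mul_comm] at h2
    rw [him, mul_comm] at h3
    have h2' := abs_lt.1 (lt_of_mul_lt_mul_right h2 hδ.le)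
    have h3' := abs_lt.1 (lt_of_mul_lt_mul_right h3 hδ.le)
    have e1 : -(4 * ((r : ℤ) + 4) + 5) < a 0 - c 0 := by exact_mod_cast h2'.1
    have e2 : a 0 - c 0 < 4 * ((r : ℤ) + 4) + 5 := by exact_mod_cast h2'.2
    have e3 : -(4 * ((r : ℤ) + 4) + 5) < a 1 - c 1 := by exact_mod_cast h3'.1
    have e4 : a 1 - c 1 < 4 * ((r : ℤ) + 4) + 5 := by exact_mod_cast h3'.2
    rw [hk]
    omega
  -- the exterior of the doubled disc lies in `{5 (r + 4) ≤ k}`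
  have hsqrt : Real.sqrt 2 < 3 / 2 := by
    rw [Real.sqrt_lt' (by norm_num)]
    norm_num
  have houter : ∀ a : Site 2, 2 * σ ≤ dist (meshPoint δ a) p → (5 * (r + 4) : ℤ) ≤ k a := by
    intro a ha
    by_contra hlt
    rw [not_le, hk] at hlt
    have e1 : ((a 0 : ℤ) : ℝ) - c 0 ≤ 5 * ((r : ℝ) + 4) - 1 := by
      have : a 0 - c 0 ≤ 5 * ((r : ℤ) + 4) - 1 := by omega
      exact_mod_cast this
    have e2 : ((c 0 : ℤ) : ℝ) - a 0 ≤ 5 * ((r : ℝ) + 4) - 1 := by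
      have : c 0 - a 0 ≤ 5 * ((r : ℤ) + 4) - 1 := by omega
      exact_mod_cast this
    have e3 : ((a 1 : ℤ) : ℝ) - c 1 ≤ 5 * ((r : ℝ) + 4) - 1 := by
      have : a 1 - c 1 ≤ 5 * ((r : ℤ) + 4) - 1 := by omega
      exact_mod_cast this
    have e4 : ((c 1 : ℤ) : ℝ) - a 1 ≤ 5 * ((r : ℝ) + 4) - 1 := by
      have : c 1 - a 1 ≤ 5 * ((r : ℤ) + 4) - 1 := by omega
      exact_mod_cast this
    have hmax : max |(meshPoint δ a - meshPoint δ c).re| |(meshPoint δ a - meshPoint δ c).im|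
        ≤ δ * (5 * ((r : ℝ) + 4) - 1) := by
      rw [hre, him]
      refine max_le ?_ ?_
      · exact mul_le_mul_of_nonneg_left (abs_le.2 ⟨by linarith, e1⟩) hδ.le
      · exact mul_le_mul_of_nonneg_left (abs_le.2 ⟨by linarith, e3⟩) hδ.le
    have hnorm : ‖meshPoint δ a - meshPoint δ c‖ ≤ Real.sqrt 2 * (δ * (5 * ((r : ℝ) + 4) - 1)) :=
      (Complex.norm_le_sqrt_two_mul_max _).trans
        (mul_le_mul_of_nonneg_left hmax (Real.sqrt_nonneg _))
    have hlow : 2 * σ - δ ≤ ‖meshPoint δ a - meshPoint δ c‖ := by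
      rw [← Complex.dist_eq]
      have := dist_triangle (meshPoint δ a) (meshPoint δ c) p
      linarith
    have hpos : 0 < δ * (5 * ((r : ℝ) + 4) - 1) :=
      mul_pos hδ (by linarith [(Nat.cast_nonneg r : (0 : ℝ) ≤ r)])
    have hrδ : (0 : ℝ) ≤ (r : ℝ) * δ := mul_nonneg (Nat.cast_nonneg r) hδ.le
    nlinarith [mul_pos (sub_pos.2 hsqrt) hpos]
  -- the test metric: the indicator of the edges with both endpoints in the box `{k ≤ N}`
  set N : ℕ := 5 * (r + 4) with hN
  set S : Set (Sym2 (Site 2)) := {e | ∀ a ∈ e, k a ≤ N} with hS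
  have hSmem : ∀ x y : Site 2, s(x, y) ∈ S ↔ k x ≤ N ∧ k y ≤ N := fun x y => by
    simp only [hS, Set.mem_setOf_eq, Sym2.mem_iff, forall_eq_or_imp, forall_eq]
  set W : Sym2 (Site 2) → ℝ≥0 := S.indicator 1 with hW
  have hWle : ∀ e, W e ≤ 1 := fun e =>
    Set.indicator_apply_le' (fun _ => le_rfl) (fun _ => zero_le_one)
  have hW1 : ∀ ⦃x y : Site 2⦄, (zdGraph 2).Adj x y → k x ≤ N → k y ≤ N → (1 : ℝ) ≤ W s(x, y) := by
    intro x y _ hx hy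
    rw [hW, Set.indicator_of_mem ((hSmem x y).2 ⟨hx, hy⟩)]
    simp
  have hW0 : ∀ x y : Site 2, (zdGraph 2).Adj x y → W s(x, y) ≠ 0 →
      (∀ i, c i - N ≤ x i ∧ x i ≤ c i + N) ∧ (∀ i, c i - N ≤ y i ∧ y i ≤ c i + N) := by
    intro x y _ hne
    have hxy : k x ≤ N ∧ k y ≤ N := by
      by_contra h'
      exact hne (Set.indicator_of_notMem (mt (hSmem x y).1 h') _)
    rw [hk, hk] at hxy
    refine ⟨fun i => ?_, fun i => ?_⟩
    · fin_cases i <;> simp <;> omega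
    · fin_cases i <;> simp <;> omega
  -- the length of every walk from the inner disc to the exterior is at least `r`
  have hdist : ((r : ℕ) : ℝ≥0∞) ≤ edgeDist (zdGraph 2) W {v : Site 2 | dist (meshPoint δ v) p < σ}
      {v : Site 2 | 2 * σ ≤ dist (meshPoint δ v) p} := by
    refine le_edgeDist fun x hx y hy q => ?_
    have h1 := walkLength_ge_min_sub_min k N W hk_adj hW1 q
    have hx' := hinner x hx
    have hy' := houter y hy
    have h2 : ((min (N : ℤ) (k y) : ℤ) : ℝ) = N := by
      rw [min_eq_left (by omega)]
      push_cast
      ring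
    have h3 : ((min (N : ℤ) (k x) : ℤ) : ℝ) ≤ 4 * ((r : ℝ) + 4) + 4 := by
      have : min (N : ℤ) (k x) ≤ 4 * ((r : ℤ) + 4) + 4 := by omega
      exact_mod_cast this
    have h4 : (r : ℝ) ≤ (walkLength W q : ℝ) := by
      have hN' : ((N : ℕ) : ℝ) = 5 * ((r : ℝ) + 4) := by rw [hN]; push_cast; ring
      linarith
    exact_mod_cast h4
  -- the area of the test metric is at most `2 (2N + 1)²`
  have harea := networkArea_le_of_box c N W hWle hW0
  -- arithmetic: `r² / (2 (2N + 1)²) ≥ 1 / 4000`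
  have hnum : 2 * (2 * N + 1) ^ 2 ≤ 4000 * r ^ 2 := by
    rw [hN]
    nlinarith
  have hr0 : (r : ℝ≥0∞) ≠ 0 := by exact_mod_cast (show r ≠ 0 by omega)
  calc (4000 : ℝ≥0∞)⁻¹ ≤ ((r : ℕ) : ℝ≥0∞) ^ 2 / ((2 * (2 * N + 1) ^ 2 : ℕ) : ℝ≥0∞) := by
        rw [ENNReal.le_div_iff_mul_le (Or.inr (pow_ne_zero 2 hr0))
          (Or.inl (ENNReal.natCast_ne_top _))]
        calc (4000 : ℝ≥0∞)⁻¹ * ((2 * (2 * N + 1) ^ 2 : ℕ) : ℝ≥0∞)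
            ≤ (4000 : ℝ≥0∞)⁻¹ * (4000 * ((r : ℕ) : ℝ≥0∞) ^ 2) := by
              gcongr
              exact_mod_cast hnum
          _ = ((r : ℕ) : ℝ≥0∞) ^ 2 := by
              rw [← mul_assoc, ENNReal.inv_mul_cancel (by norm_num) (by norm_num), one_mul]
    _ ≤ edgeDist (zdGraph 2) W {v : Site 2 | dist (meshPoint δ v) p < σ}
          {v : Site 2 | 2 * σ ≤ dist (meshPoint δ v) p} ^ 2 / networkArea (zdGraph 2) 1 W := by
        gcongr
    _ ≤ _ := le_iSup (fun W' => edgeDist (zdGraph 2) W' {v : Site 2 | dist (meshPoint δ v) p < σ}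
          {v : Site 2 | 2 * σ ≤ dist (meshPoint δ v) p} ^ 2 / networkArea (zdGraph 2) 1 W') W

end Summit.CriticalPhenomena.SAWScalingLimit.Theorems.AvoidanceLimit.Anchor

end
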